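import Literature.NumberTheory.EllipticCurves.TorsionStructureProofs
import Literature.NumberTheory.GaloisRepresentations.GL2ModEightSignData
import HarnessLib

/-!
# `ρ̄_{E,m}` as `2 × 2` matrices in a frame `E[m] ≅ (ℤ/m)²`; `ρ̄_{E,8}` modulo `4` (proofs only)

`Proofs`-style helper layer (concrete bookkeeping definitions and theorems only: no named fact, no
instance; D-0014/D-0026) for the kernel proof of T. Dokchitser, V. Dokchitser, *Surjectivity of
mod `2ⁿ` representations of elliptic curves*, Math. Z. 272 (2012) 961–964, Theorem, clause (3).
The printed proof works inside `GL₂(ℤ/8ℤ)` ("`Im ρ̄₈` surjects onto `GL₂(ℤ/4ℤ)` …"); this file is the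
dictionary between the tree's abstract `ρ̄_{E,m} : Γ_K → Aut(E[m])` (`galoisRepTorsion`,
`HasSurjectiveModNGaloisRep`) and matrices, for a Weierstrass curve `W/K` and a frame
`e : E[m] ≃+ (Fin 2 → ℤ/m)` (Silverman, *AEC*, III.6.4(b), III.7; tree theorem
`nonempty_geomTorsion_addEquiv_fin_two`):
* §1 the matrix `repMatrix e β` of an additive automorphism (`e (β P) = repMatrix e β *ᵥ e P`),
  multiplicativity, and conversely the automorphism `toAut e g` of an invertible matrix `g`;
* §2 `rhoMat W e : Γ_K →* M₂(ℤ/m)` and `HasSurjectiveModNGaloisRep m ↔` every invertible matrix is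
  some `rhoMat σ` (`hasSurjectiveModNGaloisRep_iff_matrix`);
* §3 (`m = 8`) `E[4] = 2·E[8] ⊂ E[8]`: `ρ̄₄` onto ⟹ every invertible matrix over `ℤ/8` is `≡ rhoMat σ`
  modulo `4` (`exists_rhoMat_eq_add_four_mul_of_four`). (The converse lifting `Aut E[4] ← Aut E[8]`
  is in `TwoAdicImageSurjectivityModEightLiftProofs`.)

## References

* [SilvermanAEC2009] J. H. Silverman, *The Arithmetic of Elliptic Curves*, 2nd ed., GTM 106
  (2009), III.6.4(b) (`E[m] ≅ (ℤ/m)²`), III.7 (`ρ̄_{E,m} : G → Aut(E[m]) ≅ GL₂(ℤ/mℤ)`).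
* [DokchitserDokchitserMathZ2012] T. Dokchitser, V. Dokchitser, Math. Z. 272 (2012) 961–964,
  proof of the Theorem, clause (3). [corpus:paper:arxiv-1104.5031 p0001 L58–L98]
-/

set_option autoImplicit false

noncomputable section

open scoped Classical

open Matrix WeierstrassCurve

namespace Literature.NumberTheory.EllipticCurves.DokchitserDokchitser2012

open Literature.NumberTheory.GaloisRepresentations.GL2Mod8

universe u

/-! ### §1. Matrices of additive automorphisms in a frame `A ≅ (ℤ/m)²` -/

section Frame

variable {A : Type*} [AddCommGroup A] {m : ℕ} (e : A ≃+ (Fin 2 → ZMod m))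

/-- The matrix of an additive automorphism `β` of `A` in the frame `e : A ≅ (ℤ/m)²`: column `j` is
`e (β (e⁻¹ δ_j))`. Silverman, *AEC*, III.7 (`Aut(E[m]) ≅ GL₂(ℤ/mℤ)` upon choosing a basis). [folklore] -/
def repMatrix (β : A ≃+ A) : Matrix (Fin 2) (Fin 2) (ZMod m) :=
  Matrix.of fun i j => e (β (e.symm (Pi.single j 1))) i

/-- Entries of `repMatrix`. [cite: SilvermanAEC2009, III.7 (Aut(E[m]) ≅ GL₂(ℤ/mℤ))] -/
theorem repMatrix_apply (β : A ≃+ A) (i j : Fin 2) :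
    repMatrix e β i j = e (β (e.symm (Pi.single j 1))) i := rfl

/-- A matrix over `ℤ/m` is determined by its action on the frame vectors. [folklore] -/
private theorem matrix_eq_of_mulVec_single {M N : Matrix (Fin 2) (Fin 2) (ZMod m)}
    (h : ∀ j, M *ᵥ Pi.single j 1 = N *ᵥ Pi.single j 1) : M = N := by
  ext i j
  have := congr_fun (h j) i
  simpa [Matrix.mulVec, dotProduct, Pi.single_apply, Fin.sum_univ_two] using this

variable (g : Matrix (Fin 2) (Fin 2) (ZMod m)) (d' : ZMod m) (hd : g.det * d' = 1)

/-- Multiplication by an invertible matrix `g` (inverse `d' • adj g`, `det g · d' = 1`) as an additive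
automorphism of `(ℤ/m)²`. [folklore] -/
def mulVecEquiv : (Fin 2 → ZMod m) ≃+ (Fin 2 → ZMod m) where
  toFun v := g *ᵥ v
  invFun v := (d' • g.adjugate) *ᵥ v
  left_inv v := by
    change (d' • g.adjugate) *ᵥ (g *ᵥ v) = v
    rw [Matrix.mulVec_mulVec, Matrix.smul_mul, Matrix.adjugate_mul, smul_smul, mul_comm d', hd,
      one_smul, Matrix.one_mulVec]
  right_inv v := by
    change g *ᵥ ((d' • g.adjugate) *ᵥ v) = v
    rw [Matrix.mulVec_mulVec, Matrix.mul_smul, Matrix.mul_adjugate, smul_smul, mul_comm d', hd,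
      one_smul, Matrix.one_mulVec]
  map_add' := Matrix.mulVec_add g

/-- The additive automorphism of `A` with matrix `g` in the frame `e`. Silverman, *AEC*, III.7.
[folklore] -/
def toAut : A ≃+ A := e.trans ((mulVecEquiv g d' hd).trans e.symm)

/-- `e (toAut g P) = g · e P`. [cite: SilvermanAEC2009, III.7 (Aut(E[m]) ≅ GL₂(ℤ/mℤ))] -/
theorem apply_toAut (P : A) : e (toAut e g d' hd P) = g *ᵥ e P := by
  simp [toAut, mulVecEquiv]

/-- The matrix of `toAut g` is `g`. [cite: SilvermanAEC2009, III.7 (Aut(E[m]) ≅ GL₂(ℤ/mℤ))] -/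
theorem repMatrix_toAut : repMatrix e (toAut e g d' hd) = g := by
  ext i j
  rw [repMatrix_apply, apply_toAut, e.apply_symm_apply]
  simp [Matrix.mulVec, dotProduct, Pi.single_apply]

variable [NeZero m]

/-- Decomposition along the frame: `P = (e P)₀ • e⁻¹δ₀ + (e P)₁ • e⁻¹δ₁`.
[cite: SilvermanAEC2009, Cor. III.6.4(b) (E[m] ≅ ℤ/mℤ × ℤ/mℤ)] -/
theorem eq_nsmul_add_nsmul (P : A) :
    P = (e P 0).val • e.symm (Pi.single 0 1) + (e P 1).val • e.symm (Pi.single 1 1) := by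
  apply e.injective
  rw [map_add, map_nsmul, map_nsmul, e.apply_symm_apply, e.apply_symm_apply]
  ext i
  simp only [Pi.add_apply, Pi.smul_apply, Pi.single_apply]
  fin_cases i <;> simp

/-- **`e (β P) = repMatrix e β · e P`**: the automorphism acts through its matrix.
[cite: SilvermanAEC2009, III.7 (Aut(E[m]) ≅ GL₂(ℤ/mℤ))] -/
theorem repMatrix_mulVec (β : A ≃+ A) (P : A) : e (β P) = repMatrix e β *ᵥ e P := by
  conv_lhs => rw [eq_nsmul_add_nsmul e P]
  rw [map_add, map_nsmul, map_nsmul, map_add, map_nsmul, map_nsmul]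
  ext i
  simp only [Pi.add_apply, Pi.smul_apply]
  simp [repMatrix, Matrix.mulVec, dotProduct, Fin.sum_univ_two, mul_comm]

/-- `repMatrix` of a composite is the product.
[cite: SilvermanAEC2009, III.7 (ρ̄_m is a homomorphism into GL₂(ℤ/mℤ))] -/
theorem repMatrix_eq_mul_of (β γ δ : A ≃+ A) (h : ∀ P, β P = γ (δ P)) :
    repMatrix e β = repMatrix e γ * repMatrix e δ := by
  apply matrix_eq_of_mulVec_single
  intro j
  rw [← Matrix.mulVec_mulVec, ← e.apply_symm_apply (Pi.single j 1), ← repMatrix_mulVec e δ,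
    ← repMatrix_mulVec e γ, ← h, repMatrix_mulVec e β]

/-- `repMatrix` of (anything acting as) the identity is `1`.
[cite: SilvermanAEC2009, III.7 (ρ̄_m is a homomorphism into GL₂(ℤ/mℤ))] -/
theorem repMatrix_eq_one_of (β : A ≃+ A) (h : ∀ P, β P = P) : repMatrix e β = 1 := by
  apply matrix_eq_of_mulVec_single
  intro j
  rw [Matrix.one_mulVec, ← e.apply_symm_apply (Pi.single j 1), ← repMatrix_mulVec e β, h,
    e.apply_symm_apply]

/-- Two automorphisms with the same matrix are equal.
[cite: SilvermanAEC2009, III.7 (Aut(E[m]) ≅ GL₂(ℤ/mℤ))] -/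
theorem eq_of_repMatrix_eq {β γ : A ≃+ A} (h : repMatrix e β = repMatrix e γ) (P : A) : β P = γ P :=
  e.injective (by rw [repMatrix_mulVec e β, repMatrix_mulVec e γ, h])

end Frame

/-! ### §2. `ρ̄_{E,m}` in a frame -/

variable {K : Type u} [Field K] (W : WeierstrassCurve K)

section AnyLevel

variable {m : ℕ} [NeZero m] (e : geomTorsion W m ≃+ (Fin 2 → ZMod m))

/-- **`ρ̄_{E,m}` as matrices**: `σ ↦` the matrix of `ρ̄_{E,m}(σ)` in the frame `e`, a homomorphism
`Γ_K → M₂(ℤ/mℤ)` (Silverman, *AEC*, III.7: "we obtain a representation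
`Gal(K̄/K) → Aut(E[m]) ≅ GL₂(ℤ/mℤ)`"). [cite: SilvermanAEC2009, III.7 (the representation ρ̄_m on E[m])] -/
def rhoMat : Field.absoluteGaloisGroup K →* Matrix (Fin 2) (Fin 2) (ZMod m) where
  toFun σ := repMatrix e (galoisRepTorsion W m σ).toAdd
  map_one' := repMatrix_eq_one_of e _ fun P ↦ by rw [galoisRepTorsion_apply, one_smul]
  map_mul' σ τ := repMatrix_eq_mul_of e _ _ _ fun P ↦ by
    simp only [galoisRepTorsion_apply, mul_smul]

/-- Unfolding `rhoMat`. [cite: SilvermanAEC2009, III.7 (the representation ρ̄_m on E[m])] -/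
theorem rhoMat_apply (σ : Field.absoluteGaloisGroup K) :
    rhoMat W e σ = repMatrix e (galoisRepTorsion W m σ).toAdd := rfl

/-- `e (σ P) = rhoMat σ · e P`. [cite: SilvermanAEC2009, III.7 (the representation ρ̄_m on E[m])] -/
theorem rhoMat_mulVec (σ : Field.absoluteGaloisGroup K) (P : geomTorsion W m) :
    e (σ • P) = rhoMat W e σ *ᵥ e P := by
  rw [← galoisRepTorsion_apply]
  exact repMatrix_mulVec e _ P

/-- **`ρ̄_{E,m}` is onto `Aut(E[m])` iff every invertible matrix is some `rhoMat σ`.**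
[cite: SilvermanAEC2009, III.7 (Aut(E[m]) ≅ GL₂(ℤ/mℤ))] -/
theorem hasSurjectiveModNGaloisRep_iff_matrix :
    W.HasSurjectiveModNGaloisRep m ↔
      ∀ g : Matrix (Fin 2) (Fin 2) (ZMod m), (∃ d' : ZMod m, g.det * d' = 1) →
        ∃ σ : Field.absoluteGaloisGroup K, rhoMat W e σ = g := by
  constructor
  · rintro h g ⟨d', hd⟩
    obtain ⟨σ, hσ⟩ := h (Multiplicative.ofAdd (toAut e g d' hd))
    refine ⟨σ, ?_⟩
    rw [rhoMat_apply, hσ, toAdd_ofAdd, repMatrix_toAut]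
  · intro h β
    set γ : geomTorsion W m ≃+ geomTorsion W m := β.toAdd with hγ
    have hd : (repMatrix e γ).det * (repMatrix e γ.symm).det = 1 := by
      rw [← Matrix.det_mul, ← repMatrix_eq_mul_of e (AddEquiv.refl _) γ γ.symm
        (fun P ↦ (γ.apply_symm_apply P).symm), repMatrix_eq_one_of e _ (fun P ↦ rfl),
        Matrix.det_one]
    obtain ⟨σ, hσ⟩ := h (repMatrix e γ) ⟨_, hd⟩
    refine ⟨σ, Multiplicative.toAdd.injective (AddEquiv.ext fun P ↦ ?_)⟩
    rw [← hγ]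
    exact eq_of_repMatrix_eq e hσ P

end AnyLevel

/-! ### §3. `E[4] ⊂ E[8]`: `ρ̄₈` modulo `4` is `ρ̄₄` -/

section Eight

variable (e : geomTorsion W 8 ≃+ (Fin 2 → ZMod 8))

/-- `E[4] ⊆ E[8]`. [cite: SilvermanAEC2009, III.§6 (definition of E[m])] -/
theorem mem_geomTorsion_eight_of_four {P : geomPoints W} (h : P ∈ geomTorsion W 4) :
    P ∈ geomTorsion W 8 := by
  have h4 : 4 • P = 0 := (AddSubgroup.torsionBy.nsmul_iff (A := geomPoints W) (n := 4)).mp h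
  apply (AddSubgroup.torsionBy.nsmul_iff (A := geomPoints W) (n := 8)).mpr
  rw [show (8 : ℕ) = 2 * 4 from rfl, ← smul_smul, h4, smul_zero]

/-- Membership in `E[4]` of an element of `E[8]`: `4 • P = 0`.
[cite: SilvermanAEC2009, III.§6 (definition of E[m])] -/
theorem mem_four_iff (P : geomTorsion W 8) : (P : geomPoints W) ∈ geomTorsion W 4 ↔ 4 • P = 0 := by
  rw [Subtype.ext_iff, AddSubmonoidClass.coe_nsmul, ZeroMemClass.coe_zero]
  exact AddSubgroup.torsionBy.nsmul_iff (A := geomPoints W) (n := 4)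

/-- `e (n • P) = n • e P`; so `4 • P = 0 ↔ 4 • e P = 0`.
[cite: SilvermanAEC2009, Cor. III.6.4(b) (E[m] ≅ ℤ/mℤ × ℤ/mℤ)] -/
theorem four_nsmul_eq_zero_iff (P : geomTorsion W 8) : 4 • P = 0 ↔ 4 • e P = 0 := by
  rw [← map_nsmul, e.map_eq_zero_iff]

/-- In `(ℤ/8)²`, `4 • v = 0` iff `v = 2 • c` for some `c`. [folklore] -/
private theorem exists_eq_two_nsmul_of_four {v : Fin 2 → ZMod 8} (h : 4 • v = 0) :
    ∃ c : Fin 2 → ZMod 8, v = 2 • c := by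
  have h0 : 4 * v 0 = 0 := by simpa [nsmul_eq_mul] using congr_fun h 0
  have h1 : 4 * v 1 = 0 := by simpa [nsmul_eq_mul] using congr_fun h 1
  obtain ⟨c0, hc0⟩ := exists_eq_two_mul_of_four_mul h0
  obtain ⟨c1, hc1⟩ := exists_eq_two_mul_of_four_mul h1
  refine ⟨![c0, c1], ?_⟩
  ext i
  fin_cases i <;> simp [nsmul_eq_mul, hc0, hc1]

/-- Every `P ∈ E[4]` is `e⁻¹(2c)`. [cite: SilvermanAEC2009, Cor. III.6.4(b) (E[m] ≅ ℤ/mℤ × ℤ/mℤ)] -/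
theorem exists_eq_symm_two_nsmul {P : geomTorsion W 8} (hP : 4 • P = 0) :
    ∃ c : Fin 2 → ZMod 8, P = e.symm (2 • c) := by
  obtain ⟨c, hc⟩ := exists_eq_two_nsmul_of_four ((four_nsmul_eq_zero_iff W e P).mp hP)
  exact ⟨c, e.injective (by rw [e.apply_symm_apply, hc])⟩

/-- `e⁻¹(2c) ∈ E[4]`. [cite: SilvermanAEC2009, Cor. III.6.4(b) (E[m] ≅ ℤ/mℤ × ℤ/mℤ)] -/
theorem four_nsmul_symm_two_nsmul (c : Fin 2 → ZMod 8) : 4 • e.symm (2 • c) = 0 := by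
  have h8 : ((4 * 2 : ℕ) : ZMod 8) = 0 := by decide
  rw [four_nsmul_eq_zero_iff W e, e.apply_symm_apply, smul_smul]
  ext i
  rw [Pi.smul_apply, Pi.zero_apply, nsmul_eq_mul, h8, zero_mul]

/-- The restriction of an additive automorphism of `E[8]` to `E[4]` (an automorphism maps
`4`-torsion to `4`-torsion). Silverman, *AEC*, III.7. [folklore] -/
def restrictFour (β : geomTorsion W 8 ≃+ geomTorsion W 8) : geomTorsion W 4 ≃+ geomTorsion W 4 where
  toFun P := ⟨(β ⟨P, mem_geomTorsion_eight_of_four W P.2⟩ : geomPoints W), by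
    rw [mem_four_iff, ← map_nsmul, β.map_eq_zero_iff, Subtype.ext_iff, AddSubmonoidClass.coe_nsmul]
    exact (AddSubgroup.torsionBy.nsmul_iff (A := geomPoints W) (n := 4)).mp P.2⟩
  invFun P := ⟨(β.symm ⟨P, mem_geomTorsion_eight_of_four W P.2⟩ : geomPoints W), by
    rw [mem_four_iff, ← map_nsmul, β.symm.map_eq_zero_iff, Subtype.ext_iff,
      AddSubmonoidClass.coe_nsmul]
    exact (AddSubgroup.torsionBy.nsmul_iff (A := geomPoints W) (n := 4)).mp P.2⟩
  left_inv P := by apply Subtype.ext; simp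
  right_inv P := by apply Subtype.ext; simp
  map_add' P Q := by
    apply Subtype.ext
    change ((β _ : geomTorsion W 8) : geomPoints W) = (β _ : geomPoints W) + (β _ : geomPoints W)
    rw [← AddSubgroup.coe_add, ← map_add]
    rfl

/-- Unfolding `restrictFour`. [cite: SilvermanAEC2009, III.7 (E[m] and its automorphisms)] -/
theorem coe_restrictFour (β : geomTorsion W 8 ≃+ geomTorsion W 8) (P : geomTorsion W 4) :
    (restrictFour W β P : geomPoints W) = β ⟨P, mem_geomTorsion_eight_of_four W P.2⟩ := rfl

/-- **`ρ̄₄` onto ⟹ `ρ̄₈` onto modulo `4`**: every invertible matrix over `ℤ/8` is congruent modulo `4`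
to some `rhoMat σ` ("`Im ρ̄₈` surjects onto `GL₂(ℤ/4ℤ)`": the matrix of `σ` on `E[4] = 2·E[8]` in the
basis `2e⁻¹δ₀, 2e⁻¹δ₁` is `rhoMat σ mod 4`). [cite: DokchitserDokchitserMathZ2012, proof of Theorem (3) (Im ρ̄₈ surjects onto GL₂(ℤ/4ℤ))] -/
theorem exists_rhoMat_eq_add_four_mul_of_four (h4 : W.HasSurjectiveModNGaloisRep 4) (g : M8)
    (hg : g.det * g.det = 1) :
    ∃ (σ : Field.absoluteGaloisGroup K) (T : M8), rhoMat W e σ = g + 4 * T := by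
  obtain ⟨σ, hσ⟩ := h4 (Multiplicative.ofAdd (restrictFour W (toAut e g g.det hg)))
  -- `σ` acts on `E[4] = 2·E[8]` as `toAut g`
  have hact : ∀ c : Fin 2 → ZMod 8, e (σ • e.symm (2 • c)) = g *ᵥ (2 • c) := by
    intro c
    set P : geomTorsion W 8 := e.symm (2 • c) with hP
    have hP4 : (P : geomPoints W) ∈ geomTorsion W 4 := (mem_four_iff W P).mpr
      (four_nsmul_symm_two_nsmul W e c)
    have h1 := congrArg (fun β ↦ ((β.toAdd ⟨P, hP4⟩ : geomTorsion W 4) : geomPoints W)) hσ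
    simp only [toAdd_ofAdd, galoisRepTorsion_apply, AddSubgroup.torsionBy.coe_smul,
      coe_restrictFour] at h1
    have h2 : σ • P = toAut e g g.det hg P := Subtype.ext h1
    rw [h2, apply_toAut, hP, e.apply_symm_apply]
  -- compare columns: `2 • rhoMat σ δ_j = 2 • g δ_j`
  have hcol : ∀ i j, 2 * rhoMat W e σ i j = 2 * g i j := by
    intro i j
    have h := hact (Pi.single j 1)
    rw [rhoMat_mulVec, e.apply_symm_apply, Matrix.mulVec_smul, Matrix.mulVec_smul] at h
    have h' := congr_fun h i
    simp only [Pi.smul_apply, nsmul_eq_mul, Nat.cast_ofNat, Matrix.mulVec, dotProduct,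
      Pi.single_apply, Fin.sum_univ_two] at h'
    fin_cases j <;> simpa using h'
  choose T hT using fun i j ↦ exists_eq_add_four_mul (hcol i j)
  refine ⟨σ, Matrix.of fun i j ↦ T i j, ?_⟩
  ext i j
  rw [hT i j]
  simp [Matrix.mul_apply, Matrix.ofNat_apply]

end Eight

end Literature.NumberTheory.EllipticCurves.DokchitserDokchitser2012

end
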